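import Summits.BirchSwinnertonDyer.BirchSwinnertonDyer.Theorems.ResidualThetaTransportAtTwoSignedMuSeedAtTwoPlusEvenSymplecticFreeParity
import HarnessLib

/-!
# Seed crux `SignedMuSeedAtTwoPlus` (stmt-BirchSwinnertonDyer-21438), line `ct-involution-parity`:
# calibration of the free multiplicity I — modules of `2`-rank `< 2^n` have NO free part (the norm kills `A[2]`)

Cell `bsd-wall`, width seat `bsd-wall-rtt-p4-w2` g9 (third file on the line's pure algebra; parents p651662 = stub S1
`EvenSymplecticFreeParity`, p652274 = grades `k ≥ 2`).  HONEST FRAMING: THEOREMS ONLY — no definition, no named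
fact, no instance, no `sorry`; pure algebra, no number theory imported; closes no item; BSD is NOT proved by this.

## Why (stub S3 `OddFreeGradeFromFineMuAtTwo` of the line)

S3 must show that a layer module `M ≅ (ℤ/2^k)[G_n] ⊕ C` has ODD grade-`k` free multiplicity
`m_k = log₂ #(N(U_k) + U_{k+1}) − log₂ #U_{k+1}` (`U_k = 2^(k-1) M ∩ M[2]`, `N = ∑_{i<2^n} γⁱ`), the complement `C`
being «`λ`-blocks of `2`-rank `< 2^n`, truncated signed blocks, Mordell–Weil of bounded corank» (line card).  This
file proves the first calibration fact the decomposition-free invariant `m_k` needs: **a `ℤ[C_{2^n}]`-module whose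
`2`-torsion has fewer than `2^(2^n)` elements has `N(A[2]) = 0`, hence `m_k = 0` in every grade** — the norm
`N = ∑ gⁱ` acts on the `𝔽₂`-space `V = A[2]` as `(g − 1)^(2^n − 1)` (`∑_{i<2^n} Xⁱ = (X − 1)^(2^n − 1)` in `𝔽₂[X]`),
`g − 1` is nilpotent on `V` (`(g − 1)^(2^n) = g^(2^n) − 1 = 0` in characteristic `2`), and a nilpotent endomorphism
of a space of dimension `d < 2^n` has `(g − 1)^d = 0` (Cayley–Hamilton, `IsNilpotent.charpoly_eq_X_pow_finrank`).

## What is proved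

* `normSum_apply_eq_zero_of_card_torsionBy_lt` — `g^(2^n) = 1`, `#A[2] < 2^(2^n)` ⟹ `N x = 0` for every `x ∈ A[2]`.
* `map_normSum_eq_bot_of_card_torsionBy_lt` — hence `N(U) = 0` for every `U ≤ A[2]`, and
* `log_card_sub_log_card_eq_zero_of_card_torsionBy_lt` — the grade-`(j+1)` free multiplicity (in the unfolded
  shape of `freeMult`, as in the parent files) is `0` for every `j`.
[folklore]
-/

noncomputable section

set_option autoImplicit false
set_option linter.dupNamespace false

open Finset Polynomial
open Literature.GroupTheory.FiniteAbelian

namespace Summit.BirchSwinnertonDyer.BirchSwinnertonDyer.Theorems.SignedMuAtTwo.EvenSymplecticFreeParity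

variable {A : Type*} [AddCommGroup A]

/-! ### §1 The norm kills `A[2]` when `dim A[2] < 2^n` -/

/-- **Small `2`-rank ⟹ the norm kills the `2`-torsion.** For a finite abelian group `A` and `g ∈ End A` with
`g^(2^n) = 1`: if `#A[2] < 2^(2^n)` then `(∑_{i<2^n} gⁱ) x = 0` for every `x ∈ A[2]` (on `V = A[2]`,
`∑ gⁱ = (g − 1)^(2^n − 1)` and `g − 1` is nilpotent of index `≤ dim V < 2^n`). [folklore] -/
theorem normSum_apply_eq_zero_of_card_torsionBy_lt [Finite A] (g : AddMonoid.End A) {n : ℕ}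
    (hg : g ^ (2 ^ n) = 1) (hcard : Nat.card ↥(AddSubgroup.torsionBy A 2) < 2 ^ (2 ^ n))
    {x : A} (hx : x ∈ AddSubgroup.torsionBy A 2) :
    (∑ i ∈ range (2 ^ n), (g ^ i : AddMonoid.End A)) x = 0 := by
  -- the `𝔽₂`-space `V = A[2]` and the restriction `φ` of `g`
  set V : AddSubgroup A := AddSubgroup.torsionBy A 2 with hV
  have memV : ∀ y, y ∈ V ↔ (2 : ℕ) • y = 0 := fun y ↦ by
    rw [hV, show (2 : ℤ) = ((2 : ℕ) : ℤ) from rfl]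
    exact AddSubgroup.torsionBy.nsmul_iff
  haveI : Fact (Nat.Prime 2) := ⟨Nat.prime_two⟩
  letI : Module (ZMod 2) ↥V := AddCommGroup.zmodModule (fun v ↦ Subtype.ext (by
    rw [AddSubgroup.coe_nsmul, AddSubgroup.coe_zero]
    exact (memV _).mp v.2))
  haveI : Module.Finite (ZMod 2) ↥V := Module.Finite.of_finite
  have hgV : ∀ v : ↥V, (g : A →+ A) v ∈ V := fun v ↦ by
    rw [memV, ← map_nsmul, (memV _).mp v.2, map_zero]
  let gV : ↥V →+ ↥V := ((g : A →+ A).comp V.subtype).codRestrict V hgV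
  have hgV_apply : ∀ v : ↥V, ((gV v : ↥V) : A) = g (v : A) := fun _ ↦ rfl
  let φ : Module.End (ZMod 2) ↥V := gV.toZModLinearMap 2
  have hφ_apply : ∀ v : ↥V, ((φ v : ↥V) : A) = g (v : A) := fun _ ↦ rfl
  have hφ : ∀ (i : ℕ) (v : ↥V), (((φ ^ i) v : ↥V) : A) = (g ^ i) (v : A) := by
    intro i
    induction i with
    | zero => intro v; rw [pow_zero, pow_zero, Module.End.one_apply, AddMonoid.End.coe_one, id]
    | succ i ih =>
      intro v
      rw [pow_succ', pow_succ', Module.End.mul_apply, AddMonoid.End.coe_mul, Function.comp_apply, ← ih,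
        hφ_apply]
  have hφpow : φ ^ (2 ^ n) = 1 := by
    ext v
    rw [Module.End.one_apply, hφ, hg, AddMonoid.End.coe_one, id]
  -- polynomial identities in `𝔽₂[X]`
  have hpoly1 : ((X : (ZMod 2)[X]) - 1) ^ (2 ^ n) = X ^ (2 ^ n) - 1 := by
    rw [sub_pow_char_pow_of_commute 2 n (Commute.one_right X), one_pow]
  have hX1 : (X : (ZMod 2)[X]) - 1 ≠ 0 := by
    rw [← C_1]
    exact X_sub_C_ne_zero 1
  have hpoly2 : (∑ i ∈ range (2 ^ n), (X : (ZMod 2)[X]) ^ i) = (X - 1) ^ (2 ^ n - 1) := by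
    have h := geom_sum_mul (X : (ZMod 2)[X]) (2 ^ n)
    rw [← hpoly1] at h
    obtain ⟨m, hm⟩ : ∃ m, 2 ^ n = m + 1 := ⟨2 ^ n - 1, (Nat.sub_add_cancel Nat.one_le_two_pow).symm⟩
    rw [hm, pow_succ] at h
    rw [hm, Nat.add_sub_cancel]
    exact mul_right_cancel₀ hX1 h
  -- `T = φ - 1` is nilpotent: `T^(2^n) = φ^(2^n) - 1 = 0`
  have hT : IsNilpotent (φ - 1) := by
    refine ⟨2 ^ n, ?_⟩
    have h := congrArg (Polynomial.aeval φ) hpoly1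
    rwa [map_pow, map_sub, aeval_X, map_one, map_sub, map_pow, aeval_X, map_one, hφpow,
      sub_self] at h
  -- `dim V < 2^n`
  have hd : Module.finrank (ZMod 2) ↥V < 2 ^ n := by
    have h := pow_finrank_eq_natCard 2 ↥V
    by_contra hle
    rw [not_lt] at hle
    have : 2 ^ (2 ^ n) ≤ 2 ^ Module.finrank (ZMod 2) ↥V := Nat.pow_le_pow_right two_pos hle
    omega
  -- Cayley–Hamilton: `T^(dim V) = 0`, hence `T^(2^n - 1) = 0`
  have hTd : (φ - 1) ^ Module.finrank (ZMod 2) ↥V = 0 := by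
    have h2 := (φ - 1).aeval_self_charpoly
    rwa [hT.charpoly_eq_X_pow_finrank, map_pow, aeval_X] at h2
  have hT' : (φ - 1) ^ (2 ^ n - 1) = 0 := by
    rw [← Nat.add_sub_cancel' (show Module.finrank (ZMod 2) ↥V ≤ 2 ^ n - 1 by omega), pow_add,
      hTd, zero_mul]
  -- `∑ φ^i = T^(2^n - 1) = 0`
  have hN : (∑ i ∈ range (2 ^ n), φ ^ i) = 0 := by
    have h := congrArg (Polynomial.aeval φ) hpoly2
    rw [map_sum, map_pow, map_sub, aeval_X, map_one, hT'] at h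
    rw [← h]
    exact sum_congr rfl fun i _ ↦ by rw [map_pow, aeval_X]
  -- evaluate at `x`
  have h := congrArg (fun ψ : Module.End (ZMod 2) ↥V ↦ ((ψ ⟨x, hx⟩ : ↥V) : A)) hN
  simp only [LinearMap.sum_apply, LinearMap.zero_apply, AddSubgroup.val_finsetSum, hφ,
    AddSubgroup.coe_zero] at h
  rwa [normSum_apply]

/-! ### §2 Consequences for the free multiplicity -/

/-- If `#A[2] < 2^(2^n)` then `N(U) = 0` for every `U ≤ A[2]` (`N = ∑_{i<2^n} gⁱ`, `g^(2^n) = 1`). [folklore] -/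
theorem map_normSum_eq_bot_of_card_torsionBy_lt [Finite A] (g : AddMonoid.End A) {n : ℕ}
    (hg : g ^ (2 ^ n) = 1) (hcard : Nat.card ↥(AddSubgroup.torsionBy A 2) < 2 ^ (2 ^ n))
    {U : AddSubgroup A} (hU : U ≤ AddSubgroup.torsionBy A 2) :
    U.map (∑ i ∈ range (2 ^ n), (g ^ i : AddMonoid.End A)) = ⊥ := by
  rw [AddSubgroup.map_eq_bot_iff]
  intro x hxU
  rw [AddMonoidHom.mem_ker]
  exact normSum_apply_eq_zero_of_card_torsionBy_lt g hg hcard (hU hxU)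

/-- **Calibration I: small `2`-rank ⟹ free multiplicity `0` in every grade.** For a finite abelian group `A` and
`g ∈ End A` with `g^(2^n) = 1` and `#A[2] < 2^(2^n)`: in every grade `j+1`,
`log₂ #(N(U) + U') − log₂ #U' = 0` for `U = 2^j A ∩ A[2]`, `U' = 2^(j+1) A ∩ A[2]`, `N = ∑_{i<2^n} gⁱ` (the stub's
`freeMult A (normElt g n) (j+1)` unfolded).  This is the line card's «`λ`-blocks of `2`-rank `< 2^n` contribute no
free summand». [folklore] -/
theorem log_card_sub_log_card_eq_zero_of_card_torsionBy_lt [Finite A] (g : AddMonoid.End A) {n : ℕ}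
    (hg : g ^ (2 ^ n) = 1) (hcard : Nat.card ↥(AddSubgroup.torsionBy A 2) < 2 ^ (2 ^ n)) (j : ℕ) :
    Nat.log 2 (Nat.card ↥((((2 ^ j) • AddMonoidHom.id A).range ⊓ AddSubgroup.torsionBy A 2).map
        (∑ i ∈ Finset.range (2 ^ n), (g ^ i : AddMonoid.End A)) ⊔
        (((2 ^ (j + 1)) • AddMonoidHom.id A).range ⊓ AddSubgroup.torsionBy A 2))) -
      Nat.log 2 (Nat.card ↥(((2 ^ (j + 1)) • AddMonoidHom.id A).range ⊓ AddSubgroup.torsionBy A 2)) = 0 := by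
  rw [map_normSum_eq_bot_of_card_torsionBy_lt g hg hcard inf_le_right, bot_sup_eq, Nat.sub_self]

end Summit.BirchSwinnertonDyer.BirchSwinnertonDyer.Theorems.SignedMuAtTwo.EvenSymplecticFreeParity

end
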